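/-
Copyright (c) 2026 the pub-hodgecm-mathlib formalisation cell (harness21).  Prover seat hodgecm-mathlib-B-p14 (g43): consumer file of «NORM-ONE TORUS LADDER for `K(√d)∕K`
WILD, define-free» (F0P3a-p06 (g18) seam deal (w2′) BY NAME; LH4 wild base-layer seam; census F0P3a-p06 (g17) `DUNR-H2-CENSUS.md` §1 M4∕M6); 2026-09-02.
-/
import Literature.NumberTheory.LocalFields.WildQuadraticNormOneTorus   -- ★ B-p14 (g43): Hilbert 90, depth of a quotient, no-tie, read-offs; brings the wild quadratic layer
import HarnessLib

/-!
# Wild quadratic norms — NORM-ONE TORUS, consumer file: `T = T^{(f−1)}`, the DICHOTOMY `T = (unit quotients) ⊔ (uniformiser quotients)`, `T^{(f)}` = unit quotients,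
# no odd steps, and the conductor-`j` orders `𝒪_K + ϖ^j 𝒪_E` ↔ `T^{(f+2j)}` — all define-free

Topic `NumberTheory/LocalFields`; namespace `Literature.NumberTheory.LocalFields`.  THEOREMS ONLY (no definition, no instance, no notation, no named fact, no `sorry`);
CM-free; kernel lane `--supports stmt-HodgeConjecture-24833`.  Cell `pub/hodgecm-mathlib` (D-0151), crux H413 = `stmt-HodgeConjecture-24833`; half A line LH4, DYADIC
pay-down leaf `Cruxes/H413/Lines/F0_P3c_DyadicPaydown.lean`, organs (D-UNR)∕(D-RAM) (PRINT by D74′; census F0P3a-p06 (g17) OUTCOME B: M4 (self-dual `𝒪_w[γ]`-lattice counts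
through the conductor-indexed orders) and M6 (Euler–Poincaré fixed points of `γ ∈ T(L⁺_v)`, conductor-keyed) on the wild type-(2) tori `T = Res¹ K₂^×`, `K₂ = L_w(√d)`).
Thirteenth file of the wild quadratic layer; sequel of ★ `WildQuadraticNormOneTorus`; define-free twin of ★ p851075 `Automorphic/RamifiedPlaceNormOneTorus` (N4)(N5)
(LH4-p02 (g5)) and companion of ★ MARS-to-be `Automorphic/RamifiedPlaceOrderUnitIndex` (LH4-p01 (g4): the INDEX `[T^{(f)} : T^{(f+2j)}] = q^j` lives there, in CM
currency; here only the membership laws).  HONEST LABEL: HC_CM is proved only modulo the 7 printed citations (2 remaining named inputs: hLiu418 = stmt-HodgeConjecture-24832,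
h413 = stmt-HodgeConjecture-24833) until rung 0 closes; count-neutral, Mathlib-footed, bankable base layer.

LETTERS (= ★ `WildQuadraticNormOneTorus`).  `(a, b) ∈ T_d` := `a·a − d·(b·b) = 1`, depth `v((a − 1)² − d b²)` (= `v(2(1 − a))` on `T_d`); «`(a, b)` IS THE QUOTIENT `z∕σz` OF
`z = (α, β)`» := `a·N = α² + dβ² ∧ b·N = 2αβ` with `N = α² − dβ² ≠ 0` (division-free letters); UNIT `v N = 1`, UNIFORMISER `v N = exp(−1)`; «`z` LIES IN THE CONDUCTOR-`j`
ORDER `𝒪_K + ϖ^j 𝒪_E`» := `∃ c, v((α − c)² − dβ²) ≤ exp(−2j)` (`v_E(z − c) ≥ 2j`, `c ∈ K`).  `f = 2e + 1` (odd order, `v d` not a square value) ∕ `f = 2e + 1 − s` (odd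
defect `v(d − 1) = exp(−s)`, `v 4 < v(d − 1) < 1` not a square value), `v 2 = exp(−e)`.

* §1 `depth_eq_of_quotient` — in the division-free letters, `(a − 1)² − d b² = −4dβ²∕N`.
* §2 READINGS: `depth_le_of_unit_quotient_odd` ∕ `…_odd_defect` — **UNIT QUOTIENTS LIE IN `T^{(f)}`**; `depth_eq_of_uniformizer_quotient_odd` ∕ `…_odd_defect` — **UNIFORMISER
  QUOTIENTS HAVE DEPTH EXACTLY `exp(−(f − 1))`** (★ p851075 `…_le_of_valued_eq_one` ∕ `…_of_uniformizer`).
* §3 **DICHOTOMY** `exists_unit_or_uniformizer_quotient_of_norm_one` (no normal form: `2 ≠ 0`, `d ≠ 0`, uniformiser `ϖ`): every `(a, b) ∈ T_d` is the quotient of a UNIT or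
  of a UNIFORMISER (Hilbert 90 + rescaling `z ↦ ϖ^k z` by the parity of `ord N z`) — `T = T^{(f)} ⊔ (π_E∕σπ_E)·T^{(f)}` read without the product.
* §4 CONSEQUENCES on the normal forms: `depth_le_of_norm_one_odd` ∕ `…_odd_defect` — **`T = T^{(f−1)}`** (every norm-one pair has depth `≤ exp(−(f − 1))`);
  `exists_unit_quotient_of_depth_le_odd` ∕ `…_odd_defect` — **`T^{(f)}` = UNIT QUOTIENTS** (a pair of depth `≤ exp(−f)` is a unit quotient: the uniformiser branch reads
  `exp(−(f − 1))` exactly); with §2 this is ★ p851075 (N4) `exists_eq_div_of_norm_one_of_valued_sub_one_le` define-free.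
* §5 **CONDUCTOR-`j` ORDERS ↔ `T^{(f+2j)}`** (★ p851075 (N5), MARS' filtration): `valued_four_mul_mul_sq_le_iff_exists_of_odd` ∕ `…_odd_defect` — for ANY pair `(α, β)`:
  `(∃ c, v((α − c)² − dβ²) ≤ exp(−2j)) ↔ v(4dβ²) ≤ exp(−(f + 2j))` (⇒: no-tie on `(α − c, β)` + parity; ⇐: `c = α` for odd order, `c = α + β` for odd defect — `√d ≡ 1`
  modulo the uniformiser `(√d − 1)ϖ^{−k}`); hence for a UNIT, `z` lies in the conductor-`j` order iff `z∕σz ∈ T^{(f+2j)}` (`depth_le_iff_exists_of_unit_quotient_odd` ∕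
  `…_odd_defect`), and NO ODD STEPS is the parity clause of ★ `WildQuadraticNormOneTorus` §3.
NOT HERE (honest scope): the count `[T^{(f)} : T^{(f+2j)}] = q^j` (MARS — needs a `Nat.card` dress of the pair classes; CM currency: LH4-p01 (g4)); the unramified class.

## References
* [Serre1979] J.-P. Serre, *Local Fields*, GTM 67 (1979): Ch. V §3, Ch. IV §1–§2 (`i_G(σ) = f`), Ch. X §1 (Hilbert 90).
* [Flicker1998UnitaryFL] Y. Z. Flicker, *Elementary proof of the fundamental lemma for a unitary group*, Canad. J. Math. 50 (1998), Prop. 7 p. 84, §6 p. 95 REMARK (Mars).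
* [Omeara1963] O. T. O'Meara, *Introduction to Quadratic Forms*, Grundlehren 117 (1963), §63A 63:2–63:5.
-/

set_option autoImplicit false

noncomputable section

open scoped Valued WithZero
open WithZero

namespace Literature.NumberTheory.LocalFields

section Letters
variable {K : Type*} [Field K]

/-! ## §1 The depth of a quotient in division-free letters -/

/-- **DEPTH OF A QUOTIENT, division-free letters**: if `N = α² − dβ² ≠ 0`, `a·N = α² + dβ²`, `b·N = 2αβ` then `(a − 1)·(a − 1) − d·(b·b) = −(4·d·β²)∕N`.
[cite: Serre1979, Ch. V §3] -/
theorem depth_eq_of_quotient (d : K) {α β a b : K} (hN : α * α - d * (β * β) ≠ 0)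
    (ha : a * (α * α - d * (β * β)) = α * α + d * (β * β)) (hb : b * (α * α - d * (β * β)) = 2 * α * β) :
    (a - 1) * (a - 1) - d * (b * b) = -(4 * d * (β * β) / (α * α - d * (β * β))) := by
  rw [(eq_div_iff hN).2 ha, (eq_div_iff hN).2 hb]
  exact depth_quotient_eq d hN

end Letters

section Valued
variable {K : Type*} [Field K] [Valued K ℤᵐ⁰]

/-! ## §2 Readings: unit quotients in `T^{(f)}`, uniformiser quotients at depth exactly `f − 1` -/

/-- **UNIT QUOTIENTS LIE IN `T^{(f)}`, ODD ORDER** (`f = 2e + 1`): if `(a, b)` is the quotient of a define-free unit then `v((a−1)² − d b²) ≤ exp(−(2e + 1))`.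
Twin of ★ p851075 `valued_div_galAdicCompletionMap_sub_one_le_of_valued_eq_one`. [cite: Serre1979, Ch. V §3; Ch. IV §1] -/
theorem depth_le_of_unit_quotient_odd {e : ℕ} (he : Valued.v (2 : K) = exp (-(e : ℤ))) {d : K}
    (hdodd : ∀ y : K, Valued.v d ≠ Valued.v y * Valued.v y) {α β a b : K} (hu : Valued.v (α * α - d * (β * β)) = 1)
    (ha : a * (α * α - d * (β * β)) = α * α + d * (β * β)) (hb : b * (α * α - d * (β * β)) = 2 * α * β) :
    Valued.v ((a - 1) * (a - 1) - d * (b * b)) ≤ exp (-(2 * (e : ℤ) + 1)) := by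
  have hN : α * α - d * (β * β) ≠ 0 := (Valuation.ne_zero_iff _).1 (by rw [hu]; exact one_ne_zero)
  rw [depth_eq_of_quotient d hN ha hb, Valuation.map_neg, map_div₀, hu, div_one]
  exact valued_four_mul_mul_sq_le_of_unit_odd he hdodd hu

/-- **UNIFORMISER QUOTIENTS HAVE DEPTH EXACTLY `f − 1 = 2e`, ODD ORDER**: if `(a, b)` is the quotient of a define-free uniformiser then `v((a−1)² − d b²) = exp(−2e)`.
Twin of ★ p851075 `valued_div_galAdicCompletionMap_sub_one_of_uniformizer`. [cite: Serre1979, Ch. V §3; Ch. IV §1] -/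
theorem depth_eq_of_uniformizer_quotient_odd {e : ℕ} (he : Valued.v (2 : K) = exp (-(e : ℤ))) {d : K}
    (hdodd : ∀ y : K, Valued.v d ≠ Valued.v y * Valued.v y) {α β a b : K} (hπ : Valued.v (α * α - d * (β * β)) = exp (-1 : ℤ))
    (ha : a * (α * α - d * (β * β)) = α * α + d * (β * β)) (hb : b * (α * α - d * (β * β)) = 2 * α * β) :
    Valued.v ((a - 1) * (a - 1) - d * (b * b)) = exp (-(2 * (e : ℤ))) := by
  have hN : α * α - d * (β * β) ≠ 0 := (Valuation.ne_zero_iff _).1 (by rw [hπ]; exact exp_ne_zero)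
  rw [depth_eq_of_quotient d hN ha hb, Valuation.map_neg, map_div₀, hπ,
    valued_four_mul_mul_sq_eq_of_odd_value_odd he hdodd (m := 0) (by rw [hπ]; congr 1), div_eq_iff exp_ne_zero, ← exp_add]
  congr 1
  ring

/-- **UNIT QUOTIENTS LIE IN `T^{(f)}`, ODD DEFECT** (`f = 2e + 1 − s`): if `(a, b)` is the quotient of a define-free unit then `v((a−1)² − d b²) ≤ exp(−(2e + 1 − s))`.
Twin of ★ p851075 `valued_div_galAdicCompletionMap_sub_one_le_of_valued_eq_one`. [cite: Serre1979, Ch. V §3; Ch. IV §1] [cite: Omeara1963, §63A 63:5] -/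
theorem depth_le_of_unit_quotient_odd_defect {e : ℕ} (he : Valued.v (2 : K) = exp (-(e : ℤ))) {d : K} {s : ℕ}
    (hs : Valued.v (d - 1) = exp (-(s : ℤ))) (h4d : Valued.v (4 : K) < Valued.v (d - 1)) (hd1 : Valued.v (d - 1) < 1)
    (hsodd : ∀ y : K, Valued.v (d - 1) ≠ Valued.v y * Valued.v y) {α β a b : K} (hu : Valued.v (α * α - d * (β * β)) = 1)
    (ha : a * (α * α - d * (β * β)) = α * α + d * (β * β)) (hb : b * (α * α - d * (β * β)) = 2 * α * β) :
    Valued.v ((a - 1) * (a - 1) - d * (b * b)) ≤ exp (-(2 * (e : ℤ) + 1 - s)) := by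
  have hN : α * α - d * (β * β) ≠ 0 := (Valuation.ne_zero_iff _).1 (by rw [hu]; exact one_ne_zero)
  rw [depth_eq_of_quotient d hN ha hb, Valuation.map_neg, map_div₀, hu, div_one]
  exact valued_four_mul_mul_sq_le_of_unit_odd_defect he hs h4d hd1 hsodd hu

/-- **UNIFORMISER QUOTIENTS HAVE DEPTH EXACTLY `f − 1 = 2e − s`, ODD DEFECT**.  Twin of ★ p851075 `valued_div_galAdicCompletionMap_sub_one_of_uniformizer`.
[cite: Serre1979, Ch. V §3; Ch. IV §1] [cite: Omeara1963, §63A 63:5] -/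
theorem depth_eq_of_uniformizer_quotient_odd_defect {e : ℕ} (he : Valued.v (2 : K) = exp (-(e : ℤ))) {d : K} {s : ℕ}
    (hs : Valued.v (d - 1) = exp (-(s : ℤ))) (h4d : Valued.v (4 : K) < Valued.v (d - 1)) (hd1 : Valued.v (d - 1) < 1)
    (hsodd : ∀ y : K, Valued.v (d - 1) ≠ Valued.v y * Valued.v y) {α β a b : K} (hπ : Valued.v (α * α - d * (β * β)) = exp (-1 : ℤ))
    (ha : a * (α * α - d * (β * β)) = α * α + d * (β * β)) (hb : b * (α * α - d * (β * β)) = 2 * α * β) :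
    Valued.v ((a - 1) * (a - 1) - d * (b * b)) = exp (-(2 * (e : ℤ) - s)) := by
  have hN : α * α - d * (β * β) ≠ 0 := (Valuation.ne_zero_iff _).1 (by rw [hπ]; exact exp_ne_zero)
  rw [depth_eq_of_quotient d hN ha hb, Valuation.map_neg, map_div₀, hπ,
    valued_four_mul_mul_sq_eq_of_odd_value_odd_defect he hs h4d hd1 hsodd (m := 0) (by rw [hπ]; congr 1), div_eq_iff exp_ne_zero, ← exp_add]
  congr 1
  ring

/-! ## §3 The dichotomy: every norm-one pair is a unit quotient or a uniformiser quotient -/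

/-- **DICHOTOMY** (`T = T^{(f)} ⊔ (π_E∕σπ_E)·T^{(f)}` read as: quotient of a UNIT or of a UNIFORMISER): `2 ≠ 0`, `d ≠ 0`, `v ϖ = exp(−1)`.  If `a·a − d·(b·b) = 1` then
`(a, b)` is the quotient of some `z = (α, β)` with `v(α² − dβ²) = 1` OR `= exp(−1)` — Hilbert 90 (★ `exists_quotient_of_norm_one`) and the rescaling `z ↦ ϖ^k·z` by the
parity of `ord(N z)` (the quotient is unchanged, the letters scale by `ϖ^{2k}`).  Twin of ★ p851075 `exists_div_galAdicCompletionMap_eq_or`.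
[cite: Serre1979, Ch. X §1; Ch. V §3] -/
theorem exists_unit_or_uniformizer_quotient_of_norm_one (h2 : (2 : K) ≠ 0) {ϖ : K} (hϖ : Valued.v ϖ = exp (-1 : ℤ)) {d : K} (hd0 : d ≠ 0)
    {a b : K} (h : a * a - d * (b * b) = 1) :
    ∃ α β : K, (Valued.v (α * α - d * (β * β)) = 1 ∨ Valued.v (α * α - d * (β * β)) = exp (-1 : ℤ)) ∧
      a * (α * α - d * (β * β)) = α * α + d * (β * β) ∧ b * (α * α - d * (β * β)) = 2 * α * β := by
  obtain ⟨α, β, hN, ha, hb⟩ := exists_quotient_of_norm_one h2 hd0 h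
  have hϖ0 : ϖ ≠ 0 := (Valuation.ne_zero_iff _).1 (by rw [hϖ]; exact exp_ne_zero)
  have hvN : Valued.v (α * α - d * (β * β)) ≠ 0 := (Valuation.ne_zero_iff _).2 hN
  -- rescale by `c = ϖ^k`
  have hscale : ∀ c : K, c ≠ 0 →
      (c * α * (c * α) - d * (c * β * (c * β)) = c * c * (α * α - d * (β * β))) ∧
      a * (c * α * (c * α) - d * (c * β * (c * β))) = c * α * (c * α) + d * (c * β * (c * β)) ∧
      b * (c * α * (c * α) - d * (c * β * (c * β))) = 2 * (c * α) * (c * β) := by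
    intro c _
    refine ⟨by ring, ?_, ?_⟩
    · linear_combination c * c * ha
    · linear_combination c * c * hb
  rcases Int.even_or_odd (log (Valued.v (α * α - d * (β * β)))) with ⟨k, hk⟩ | ⟨k, hk⟩
  · -- even order `2k`: `c = ϖ^k` gives a unit
    obtain ⟨hN', ha', hb'⟩ := hscale (ϖ ^ k) (zpow_ne_zero _ hϖ0)
    refine ⟨ϖ ^ k * α, ϖ ^ k * β, Or.inl ?_, ha', hb'⟩
    rw [hN', map_mul, map_mul, valued_uniformizer_zpow hϖ, ← exp_log hvN, hk, ← exp_add, ← exp_add, ← exp_zero]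
    congr 1
    ring
  · -- odd order `2k + 1`: `c = ϖ^(k+1)` gives a uniformiser
    obtain ⟨hN', ha', hb'⟩ := hscale (ϖ ^ (k + 1)) (zpow_ne_zero _ hϖ0)
    refine ⟨ϖ ^ (k + 1) * α, ϖ ^ (k + 1) * β, Or.inr ?_, ha', hb'⟩
    rw [hN', map_mul, map_mul, valued_uniformizer_zpow hϖ, ← exp_log hvN, hk, ← exp_add, ← exp_add]
    congr 1
    ring

/-! ## §4 Consequences on the normal forms: `T = T^{(f−1)}`, and `T^{(f)}` = unit quotients -/

/-- **`T = T^{(f−1)}`, ODD ORDER**: every norm-one pair has depth `≤ exp(−2e)` (`f − 1 = 2e`). [cite: Serre1979, Ch. V §3] -/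
theorem depth_le_of_norm_one_odd {e : ℕ} (he : Valued.v (2 : K) = exp (-(e : ℤ))) {ϖ : K} (hϖ : Valued.v ϖ = exp (-1 : ℤ)) {d : K}
    (hdodd : ∀ y : K, Valued.v d ≠ Valued.v y * Valued.v y) {a b : K} (h : a * a - d * (b * b) = 1) :
    Valued.v ((a - 1) * (a - 1) - d * (b * b)) ≤ exp (-(2 * (e : ℤ))) := by
  have h2 : (2 : K) ≠ 0 := (Valuation.ne_zero_iff _).1 (by rw [he]; exact exp_ne_zero)
  have hd0 : d ≠ 0 := fun h0 => hdodd 0 (by rw [h0, map_zero, mul_zero])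
  obtain ⟨α, β, hcase, ha, hb⟩ := exists_unit_or_uniformizer_quotient_of_norm_one h2 hϖ hd0 h
  rcases hcase with hu | hπ
  · refine (depth_le_of_unit_quotient_odd he hdodd hu ha hb).trans ?_
    rw [exp_le_exp]
    omega
  · exact (depth_eq_of_uniformizer_quotient_odd he hdodd hπ ha hb).le

/-- **`T^{(f)}` = UNIT QUOTIENTS, ODD ORDER**: a norm-one pair of depth `≤ exp(−(2e + 1))` is the quotient of a define-free UNIT (the uniformiser branch of the dichotomy reads
`exp(−2e)` exactly).  Twin of ★ p851075 (N4) `exists_eq_div_of_norm_one_of_valued_sub_one_le`. [cite: Serre1979, Ch. V §3; Ch. X §1] -/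
theorem exists_unit_quotient_of_depth_le_odd {e : ℕ} (he : Valued.v (2 : K) = exp (-(e : ℤ))) {ϖ : K} (hϖ : Valued.v ϖ = exp (-1 : ℤ)) {d : K}
    (hdodd : ∀ y : K, Valued.v d ≠ Valued.v y * Valued.v y) {a b : K} (h : a * a - d * (b * b) = 1)
    (hdepth : Valued.v ((a - 1) * (a - 1) - d * (b * b)) ≤ exp (-(2 * (e : ℤ) + 1))) :
    ∃ α β : K, Valued.v (α * α - d * (β * β)) = 1 ∧
      a * (α * α - d * (β * β)) = α * α + d * (β * β) ∧ b * (α * α - d * (β * β)) = 2 * α * β := by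
  have h2 : (2 : K) ≠ 0 := (Valuation.ne_zero_iff _).1 (by rw [he]; exact exp_ne_zero)
  have hd0 : d ≠ 0 := fun h0 => hdodd 0 (by rw [h0, map_zero, mul_zero])
  obtain ⟨α, β, hcase, ha, hb⟩ := exists_unit_or_uniformizer_quotient_of_norm_one h2 hϖ hd0 h
  rcases hcase with hu | hπ
  · exact ⟨α, β, hu, ha, hb⟩
  · exfalso
    have heq := depth_eq_of_uniformizer_quotient_odd he hdodd hπ ha hb
    rw [heq, exp_le_exp] at hdepth
    omega

/-- **`T = T^{(f−1)}`, ODD DEFECT**: every norm-one pair has depth `≤ exp(−(2e − s))` (`f − 1 = 2e − s`). [cite: Serre1979, Ch. V §3] [cite: Omeara1963, §63A 63:5] -/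
theorem depth_le_of_norm_one_odd_defect {e : ℕ} (he : Valued.v (2 : K) = exp (-(e : ℤ))) {ϖ : K} (hϖ : Valued.v ϖ = exp (-1 : ℤ)) {d : K} {s : ℕ}
    (hs : Valued.v (d - 1) = exp (-(s : ℤ))) (h4d : Valued.v (4 : K) < Valued.v (d - 1)) (hd1 : Valued.v (d - 1) < 1)
    (hsodd : ∀ y : K, Valued.v (d - 1) ≠ Valued.v y * Valued.v y) {a b : K} (h : a * a - d * (b * b) = 1) :
    Valued.v ((a - 1) * (a - 1) - d * (b * b)) ≤ exp (-(2 * (e : ℤ) - s)) := by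
  have h2 : (2 : K) ≠ 0 := (Valuation.ne_zero_iff _).1 (by rw [he]; exact exp_ne_zero)
  have hd0 : d ≠ 0 := by
    rintro rfl
    rw [zero_sub, Valuation.map_neg, map_one] at hd1
    exact lt_irrefl _ hd1
  obtain ⟨α, β, hcase, ha, hb⟩ := exists_unit_or_uniformizer_quotient_of_norm_one h2 hϖ hd0 h
  rcases hcase with hu | hπ
  · refine (depth_le_of_unit_quotient_odd_defect he hs h4d hd1 hsodd hu ha hb).trans ?_
    rw [exp_le_exp]
    omega
  · exact (depth_eq_of_uniformizer_quotient_odd_defect he hs h4d hd1 hsodd hπ ha hb).le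

/-- **`T^{(f)}` = UNIT QUOTIENTS, ODD DEFECT**: a norm-one pair of depth `≤ exp(−(2e + 1 − s))` is the quotient of a define-free UNIT.  Twin of ★ p851075 (N4).
[cite: Serre1979, Ch. V §3; Ch. X §1] [cite: Omeara1963, §63A 63:5] -/
theorem exists_unit_quotient_of_depth_le_odd_defect {e : ℕ} (he : Valued.v (2 : K) = exp (-(e : ℤ))) {ϖ : K} (hϖ : Valued.v ϖ = exp (-1 : ℤ)) {d : K} {s : ℕ}
    (hs : Valued.v (d - 1) = exp (-(s : ℤ))) (h4d : Valued.v (4 : K) < Valued.v (d - 1)) (hd1 : Valued.v (d - 1) < 1)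
    (hsodd : ∀ y : K, Valued.v (d - 1) ≠ Valued.v y * Valued.v y) {a b : K} (h : a * a - d * (b * b) = 1)
    (hdepth : Valued.v ((a - 1) * (a - 1) - d * (b * b)) ≤ exp (-(2 * (e : ℤ) + 1 - s))) :
    ∃ α β : K, Valued.v (α * α - d * (β * β)) = 1 ∧
      a * (α * α - d * (β * β)) = α * α + d * (β * β) ∧ b * (α * α - d * (β * β)) = 2 * α * β := by
  have h2 : (2 : K) ≠ 0 := (Valuation.ne_zero_iff _).1 (by rw [he]; exact exp_ne_zero)
  have hd0 : d ≠ 0 := by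
    rintro rfl
    rw [zero_sub, Valuation.map_neg, map_one] at hd1
    exact lt_irrefl _ hd1
  obtain ⟨α, β, hcase, ha, hb⟩ := exists_unit_or_uniformizer_quotient_of_norm_one h2 hϖ hd0 h
  rcases hcase with hu | hπ
  · exact ⟨α, β, hu, ha, hb⟩
  · exfalso
    have heq := depth_eq_of_uniformizer_quotient_odd_defect he hs h4d hd1 hsodd hπ ha hb
    rw [heq, exp_le_exp] at hdepth
    omega

/-! ## §5 The conductor-`j` orders `𝒪_K + ϖ^j 𝒪_E` and `T^{(f+2j)}` -/

/-- `ℤᵐ⁰` bookkeeping: `exp a · X ≤ exp b ↔ X ≤ exp(b − a)`. [cite: Serre1979, Ch. II §1] -/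
theorem exp_mul_le_exp_iff {X : ℤᵐ⁰} {a b : ℤ} : exp a * X ≤ exp b ↔ X ≤ exp (b - a) := by
  by_cases hX : X = 0
  · simp [hX]
  · rw [← exp_log hX, ← exp_add, exp_le_exp, exp_le_exp]
    omega

/-- **CONDUCTOR-`j` ORDER ↔ DEEP QUOTIENT, ODD ORDER**: `v 2 = exp(−e)`, `v ϖ = exp(−1)`, `v d` not a square value; for ANY pair `(α, β)` and `j : ℕ`:
`(∃ c, v((α − c)·(α − c) − d·(β·β)) ≤ exp(−2j)) ↔ v(4·d·(β·β)) ≤ exp(−(2e + 1 + 2j))` — `z ∈ 𝒪_K + ϖ^j 𝒪_E` iff the σ-depth `v(4dβ²)` of `z` is `≥ f + 2j`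
(⇒ no-tie on `(α − c, β)`: `v d·v β² ≤ exp(−2j)`, and `≠` by parity; ⇐ `c = α`: `z − α = β√d`).  Twin of ★ p851075 (N5) `valued_sub_one_le_iff_exists_of_norm_one`, of ★
MARS-to-be's `V_j`. [cite: Serre1979, Ch. V §3] [cite: Flicker1998UnitaryFL, Prop. 7 p. 84; §6 p. 95] -/
theorem valued_four_mul_mul_sq_le_iff_exists_of_odd {e : ℕ} (he : Valued.v (2 : K) = exp (-(e : ℤ))) {ϖ : K} (hϖ : Valued.v ϖ = exp (-1 : ℤ))
    {d : K} (hdodd : ∀ y : K, Valued.v d ≠ Valued.v y * Valued.v y) (α β : K) (j : ℕ) :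
    (∃ c : K, Valued.v ((α - c) * (α - c) - d * (β * β)) ≤ exp (-(2 * (j : ℤ)))) ↔
      Valued.v (4 * d * (β * β)) ≤ exp (-(2 * (e : ℤ) + 1 + 2 * j)) := by
  have h4 : Valued.v (4 : K) = exp (-(2 * (e : ℤ))) := by
    rw [show (4 : K) = 2 * 2 by norm_num, map_mul, he, ← exp_add]
    congr 1
    ring
  have hsplit : Valued.v (4 * d * (β * β)) = exp (-(2 * (e : ℤ))) * (Valued.v d * (Valued.v β * Valued.v β)) := by
    rw [show 4 * d * (β * β) = 4 * (d * (β * β)) by ring, map_mul, map_mul, map_mul, h4]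
  rw [hsplit, exp_mul_le_exp_iff, show (-(2 * (e : ℤ) + 1 + 2 * j) - -(2 * (e : ℤ))) = -(2 * (j : ℤ) + 1) by ring]
  constructor
  · rintro ⟨c, hc⟩
    have hle : Valued.v d * (Valued.v β * Valued.v β) ≤ exp (-(2 * (j : ℤ))) :=
      le_trans (by rw [valued_sq_sub_mul_sq_eq_max_of_odd hdodd (α - c) β]; exact le_max_right _ _) hc
    refine le_exp_neg_add_one_of_lt_exp_neg (lt_of_le_of_ne hle fun heq => ?_)
    -- parity: `v d · v β² = exp(−2j)` would make `v d` a square value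
    have hβ : β ≠ 0 := by
      rintro rfl
      rw [map_zero, mul_zero, mul_zero] at heq
      exact exp_ne_zero heq.symm
    have hvβ : Valued.v β ≠ 0 := (Valuation.ne_zero_iff _).2 hβ
    refine hdodd (ϖ ^ j / β) ?_
    rw [map_div₀, map_pow, hϖ, div_mul_div_comm, eq_div_iff (mul_ne_zero hvβ hvβ), heq, ← pow_add, ← exp_nsmul]
    congr 1
    simp only [nsmul_eq_mul]
    push_cast
    ring
  · intro h
    refine ⟨α, ?_⟩
    rw [sub_self, zero_mul, zero_sub, Valuation.map_neg, map_mul, map_mul]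
    refine h.trans ?_
    rw [exp_le_exp]
    omega

/-- **CONDUCTOR-`j` ORDER ↔ DEEP QUOTIENT, ODD DEFECT** (`f = 2e + 1 − s`): with `v(d − 1) = exp(−s)`, `v 4 < v(d − 1) < 1` not a square value and a uniformiser `ϖ`, for ANY
pair `(α, β)` and `j : ℕ`: `(∃ c, v((α − c)·(α − c) − d·(β·β)) ≤ exp(−2j)) ↔ v(4·d·(β·β)) ≤ exp(−(2e + 1 − s + 2j))` (⇒ no-tie + parity of `s`; ⇐ `c = α + β`:
`z − (α + β) = β(√d − 1)` and `(√d − 1)ϖ^{−k}` is a uniformiser).  Twin of ★ p851075 (N5). [cite: Serre1979, Ch. V §3] [cite: Flicker1998UnitaryFL, Prop. 7 p. 84; §6 p. 95] -/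
theorem valued_four_mul_mul_sq_le_iff_exists_of_odd_defect {e : ℕ} (he : Valued.v (2 : K) = exp (-(e : ℤ))) {ϖ : K} (hϖ : Valued.v ϖ = exp (-1 : ℤ))
    {d : K} {s : ℕ} (hs : Valued.v (d - 1) = exp (-(s : ℤ))) (hd1 : Valued.v (d - 1) < 1) (h4d : Valued.v (4 : K) < Valued.v (d - 1))
    (hsodd : ∀ y : K, Valued.v (d - 1) ≠ Valued.v y * Valued.v y) (α β : K) (j : ℕ) :
    (∃ c : K, Valued.v ((α - c) * (α - c) - d * (β * β)) ≤ exp (-(2 * (j : ℤ)))) ↔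
      Valued.v (4 * d * (β * β)) ≤ exp (-(2 * (e : ℤ) + 1 - s + 2 * j)) := by
  have h4 : Valued.v (4 : K) = exp (-(2 * (e : ℤ))) := by
    rw [show (4 : K) = 2 * 2 by norm_num, map_mul, he, ← exp_add]
    congr 1
    ring
  have hvd : Valued.v d = 1 := by
    rw [show d = 1 + (d - 1) by ring]
    exact Valuation.map_one_add_of_lt _ hd1
  -- `s` is odd
  obtain ⟨k, hk⟩ : Odd s := by
    rcases Nat.even_or_odd s with ⟨k, hk⟩ | hodd
    · exfalso
      refine hsodd (ϖ ^ k) ?_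
      rw [hs, map_pow, hϖ, ← pow_add, ← exp_nsmul]
      congr 1
      simp only [nsmul_eq_mul]
      push_cast
      omega
    · exact hodd
  have hsplit : Valued.v (4 * d * (β * β)) = exp (-(2 * (e : ℤ))) * (Valued.v β * Valued.v β) := by
    rw [show 4 * d * (β * β) = 4 * (d * (β * β)) by ring, map_mul, map_mul, map_mul, h4, hvd, one_mul]
  have hββ : ∀ c : K, Valued.v ((α - c) * (α - c) - d * (β * β)) ≥ exp (-(s : ℤ)) * (Valued.v β * Valued.v β) := fun c => by
    rw [(valued_sq_sub_mul_sq_eq_max_of_odd_defect h4d hsodd (α - c) β).1, hs]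
    exact le_max_right _ _
  rw [hsplit, exp_mul_le_exp_iff, show (-(2 * (e : ℤ) + 1 - s + 2 * j) - -(2 * (e : ℤ))) = (s : ℤ) - 1 - 2 * j by ring]
  constructor
  · rintro ⟨c, hc⟩
    have hle : exp (-(s : ℤ)) * (Valued.v β * Valued.v β) ≤ exp (-(2 * (j : ℤ))) := (hββ c).trans hc
    have hlt : exp (-(s : ℤ)) * (Valued.v β * Valued.v β) < exp (-(2 * (j : ℤ))) := by
      refine lt_of_le_of_ne hle fun heq => ?_
      have hβ : β ≠ 0 := by
        rintro rfl
        rw [map_zero, mul_zero, mul_zero] at heq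
        exact exp_ne_zero heq.symm
      have hvβ : Valued.v β ≠ 0 := (Valuation.ne_zero_iff _).2 hβ
      obtain ⟨m, hm⟩ : ∃ m : ℤ, Valued.v β = exp m := ⟨_, (exp_log hvβ).symm⟩
      rw [hm, ← exp_add, ← exp_add, exp_inj] at heq
      omega
    have hle' := le_exp_neg_add_one_of_lt_exp_neg hlt
    rw [exp_mul_le_exp_iff] at hle'
    refine hle'.trans ?_
    rw [exp_le_exp]
    omega
  · intro h
    refine ⟨α + β, ?_⟩
    rw [show (α - (α + β)) * (α - (α + β)) - d * (β * β) = -((d - 1) * (β * β)) by ring, Valuation.map_neg, map_mul, map_mul, hs,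
      exp_mul_le_exp_iff]
    refine h.trans ?_
    rw [exp_le_exp]
    omega

/-- **FOR A UNIT: `z ∈ 𝒪_K + ϖ^j 𝒪_E ⟺ z∕σz ∈ T^{(f+2j)}`, ODD ORDER** — in the division-free quotient letters (`v N = 1`, `a·N = α² + dβ²`, `b·N = 2αβ`):
`(∃ c, v((α − c)² − dβ²) ≤ exp(−2j)) ↔ v((a − 1)² − d b²) ≤ exp(−(2e + 1 + 2j))`.  With ★ `valued_four_mul_mul_sq_ne_sq_of_odd` (no odd steps) this is the membership half
of MARS' filtration `[T^{(f)} : T^{(f+2j)}] = q^j`. [cite: Flicker1998UnitaryFL, Prop. 7 p. 84; §6 p. 95] [cite: Serre1979, Ch. V §3] -/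
theorem depth_le_iff_exists_of_unit_quotient_odd {e : ℕ} (he : Valued.v (2 : K) = exp (-(e : ℤ))) {ϖ : K} (hϖ : Valued.v ϖ = exp (-1 : ℤ))
    {d : K} (hdodd : ∀ y : K, Valued.v d ≠ Valued.v y * Valued.v y) {α β a b : K} (hu : Valued.v (α * α - d * (β * β)) = 1)
    (ha : a * (α * α - d * (β * β)) = α * α + d * (β * β)) (hb : b * (α * α - d * (β * β)) = 2 * α * β) (j : ℕ) :
    (∃ c : K, Valued.v ((α - c) * (α - c) - d * (β * β)) ≤ exp (-(2 * (j : ℤ)))) ↔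
      Valued.v ((a - 1) * (a - 1) - d * (b * b)) ≤ exp (-(2 * (e : ℤ) + 1 + 2 * j)) := by
  have hN : α * α - d * (β * β) ≠ 0 := (Valuation.ne_zero_iff _).1 (by rw [hu]; exact one_ne_zero)
  rw [depth_eq_of_quotient d hN ha hb, Valuation.map_neg, map_div₀, hu, div_one]
  exact valued_four_mul_mul_sq_le_iff_exists_of_odd he hϖ hdodd α β j

/-- **FOR A UNIT: `z ∈ 𝒪_K + ϖ^j 𝒪_E ⟺ z∕σz ∈ T^{(f+2j)}`, ODD DEFECT** (`f = 2e + 1 − s`), in the division-free quotient letters.  With ★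
`valued_four_mul_mul_sq_eq_sq_of_odd_defect` (no odd steps) this is the membership half of MARS' filtration. [cite: Flicker1998UnitaryFL, Prop. 7 p. 84; §6 p. 95]
[cite: Serre1979, Ch. V §3] -/
theorem depth_le_iff_exists_of_unit_quotient_odd_defect {e : ℕ} (he : Valued.v (2 : K) = exp (-(e : ℤ))) {ϖ : K} (hϖ : Valued.v ϖ = exp (-1 : ℤ))
    {d : K} {s : ℕ} (hs : Valued.v (d - 1) = exp (-(s : ℤ))) (hd1 : Valued.v (d - 1) < 1) (h4d : Valued.v (4 : K) < Valued.v (d - 1))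
    (hsodd : ∀ y : K, Valued.v (d - 1) ≠ Valued.v y * Valued.v y) {α β a b : K} (hu : Valued.v (α * α - d * (β * β)) = 1)
    (ha : a * (α * α - d * (β * β)) = α * α + d * (β * β)) (hb : b * (α * α - d * (β * β)) = 2 * α * β) (j : ℕ) :
    (∃ c : K, Valued.v ((α - c) * (α - c) - d * (β * β)) ≤ exp (-(2 * (j : ℤ)))) ↔
      Valued.v ((a - 1) * (a - 1) - d * (b * b)) ≤ exp (-(2 * (e : ℤ) + 1 - s + 2 * j)) := by
  have hN : α * α - d * (β * β) ≠ 0 := (Valuation.ne_zero_iff _).1 (by rw [hu]; exact one_ne_zero)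
  rw [depth_eq_of_quotient d hN ha hb, Valuation.map_neg, map_div₀, hu, div_one]
  exact valued_four_mul_mul_sq_le_iff_exists_of_odd_defect he hϖ hs hd1 h4d hsodd α β j

end Valued

end Literature.NumberTheory.LocalFields
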